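import Summits.ValiantsHypothesis.ValiantsHypothesis.Theorems.SymPencilPerFourHyperplaneFlowBlocks

/-!
# Route `SymPencil` — exact flows of `per [v; ·]` on a hyperplane: off-diagonal blocks by compensation in the TARGET row
# (tool file for the one-row defect-2 cell `(12,4,2)` of `sdc(per_4)`, `--supports`
# stmt-ValiantsHypothesis-5674; nothing here bears on `VP ≠ VNP`)

Companion of `SymPencilPerFourHyperplaneFlowBlocks.offDiag_row0_via2`: the same conclusion (the blocks of `X`
into row `0` are `u ⊗ ℓ_b`) when the linear form sees row `0` ITSELF (`ℓ(e₀ ⊗ t) = 1`), from the test matrices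
`y' = (s t, y₁, τ y₂)`, `s = −(ℓ(e₁⊗y₁) + τ ℓ(e₂⊗y₂))`: `firstOrder_row0_expand` (the four `τ`-coefficients, by
`ring`), `row0_coeffs`, **`offDiag_row0`** (τ⁰/τ³ kill the coupling terms, τ¹/τ² are hyperplane-quad /
restricted-quad shapes, and the two vectors agree by density).  Not needed by the two-row assembly but it
covers the complementary configuration.
Elementary; no definitions, no named facts. [folklore]
-/

noncomputable section

-- single-conjunct layout: Sub = Summit, duplicated namespace component intended
set_option linter.dupNamespace false

namespace Summit.ValiantsHypothesis.ValiantsHypothesis.Theorems.SymPencilPerFourHyperplaneFlowBlocks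

open Matrix
open Summit.ValiantsHypothesis.ValiantsHypothesis.Theorems.SymPencilPerFourInnerRankRows
open Summit.ValiantsHypothesis.ValiantsHypothesis.Theorems.SymPencilPerFourRowForms
open Summit.ValiantsHypothesis.ValiantsHypothesis.Theorems.SymPencilPerFourRowNoLinearFactor

variable {K : Type*} [Field K]

/-- **Row-0 compensation, expansion in the scaling parameter.**  For `y' = (s t, y₁, τ y₂)` with
`s = −(L₁ + τ L₂)` and `X y' = s A + B + τ C` (rows `A a, B a, C a`), the first-order quantity
`DF_v(y')[X y']` is an explicit cubic in `τ`. [folklore] -/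
theorem firstOrder_row0_expand (v t y₁ y₂ : Fin 4 → K) (A B C : Fin 3 → Fin 4 → K) (L₁ L₂ τ : K) :
    let s : K := -(L₁ + τ * L₂)
    (Matrix.of ![v, s • A 0 + B 0 + τ • C 0, y₁, τ • y₂]).permanent
      + (Matrix.of ![v, s • t, s • A 1 + B 1 + τ • C 1, τ • y₂]).permanent
      + (Matrix.of ![v, s • t, y₁, s • A 2 + B 2 + τ • C 2]).permanent =
    (L₁ ^ 2 * (Matrix.of ![v, t, y₁, A 2]).permanent - L₁ * (Matrix.of ![v, t, y₁, B 2]).permanent)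
    + τ * (-L₁ * (Matrix.of ![v, A 0, y₁, y₂]).permanent + (Matrix.of ![v, B 0, y₁, y₂]).permanent
        + L₁ ^ 2 * (Matrix.of ![v, t, A 1, y₂]).permanent - L₁ * (Matrix.of ![v, t, B 1, y₂]).permanent
        + 2 * L₁ * L₂ * (Matrix.of ![v, t, y₁, A 2]).permanent - L₂ * (Matrix.of ![v, t, y₁, B 2]).permanent
        - L₁ * (Matrix.of ![v, t, y₁, C 2]).permanent)
    + τ ^ 2 * (-L₂ * (Matrix.of ![v, A 0, y₁, y₂]).permanent + (Matrix.of ![v, C 0, y₁, y₂]).permanent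
        + 2 * L₁ * L₂ * (Matrix.of ![v, t, A 1, y₂]).permanent - L₂ * (Matrix.of ![v, t, B 1, y₂]).permanent
        - L₁ * (Matrix.of ![v, t, C 1, y₂]).permanent
        + L₂ ^ 2 * (Matrix.of ![v, t, y₁, A 2]).permanent - L₂ * (Matrix.of ![v, t, y₁, C 2]).permanent)
    + τ ^ 3 * (L₂ ^ 2 * (Matrix.of ![v, t, A 1, y₂]).permanent - L₂ * (Matrix.of ![v, t, C 1, y₂]).permanent) := by
  intro s
  simp only [permanent_of_rows, Pi.add_apply, Pi.smul_apply, smul_eq_mul, s]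
  ring

/-- **Row-0 compensation: the four coefficient identities.**  If `DF_v(y)[X y] = 0` on `ker ℓ` and
`ℓ(e₀ ⊗ t) = 1`, then for all `y₁, y₂` the coefficients of `firstOrder_row0_expand` vanish
(`A = X(e₀⊗t)`, `B = X(e₁⊗y₁)`, `C = X(e₂⊗y₂)`, `L_b = ℓ(e_b ⊗ y_b)`). [folklore] -/
theorem row0_coeffs [CharZero K] (v : Fin 4 → K) (X : (Fin 3 → Fin 4 → K) →ₗ[K] (Fin 3 → Fin 4 → K))
    (ℓ : (Fin 3 → Fin 4 → K) →ₗ[K] K) (t : Fin 4 → K) (ht : ℓ (Pi.single 0 t) = 1)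
    (hD : ∀ y : Fin 3 → Fin 4 → K, ℓ y = 0 →
      (Matrix.of ![v, X y 0, y 1, y 2]).permanent + (Matrix.of ![v, y 0, X y 1, y 2]).permanent +
        (Matrix.of ![v, y 0, y 1, X y 2]).permanent = 0)
    (y₁ y₂ : Fin 4 → K) :
    let A := X (Pi.single 0 t); let B := X (Pi.single 1 y₁); let C := X (Pi.single 2 y₂)
    let L₁ := ℓ (Pi.single 1 y₁); let L₂ := ℓ (Pi.single 2 y₂)
    (L₁ ^ 2 * (Matrix.of ![v, t, y₁, A 2]).permanent - L₁ * (Matrix.of ![v, t, y₁, B 2]).permanent = 0) ∧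
    (-L₁ * (Matrix.of ![v, A 0, y₁, y₂]).permanent + (Matrix.of ![v, B 0, y₁, y₂]).permanent
        + L₁ ^ 2 * (Matrix.of ![v, t, A 1, y₂]).permanent - L₁ * (Matrix.of ![v, t, B 1, y₂]).permanent
        + 2 * L₁ * L₂ * (Matrix.of ![v, t, y₁, A 2]).permanent - L₂ * (Matrix.of ![v, t, y₁, B 2]).permanent
        - L₁ * (Matrix.of ![v, t, y₁, C 2]).permanent = 0) ∧
    (-L₂ * (Matrix.of ![v, A 0, y₁, y₂]).permanent + (Matrix.of ![v, C 0, y₁, y₂]).permanent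
        + 2 * L₁ * L₂ * (Matrix.of ![v, t, A 1, y₂]).permanent - L₂ * (Matrix.of ![v, t, B 1, y₂]).permanent
        - L₁ * (Matrix.of ![v, t, C 1, y₂]).permanent
        + L₂ ^ 2 * (Matrix.of ![v, t, y₁, A 2]).permanent - L₂ * (Matrix.of ![v, t, y₁, C 2]).permanent = 0) ∧
    (L₂ ^ 2 * (Matrix.of ![v, t, A 1, y₂]).permanent - L₂ * (Matrix.of ![v, t, C 1, y₂]).permanent = 0) := by
  intro A B C L₁ L₂
  refine cubic_coeffs_eq_zero _ _ _ _ fun τ => ?_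
  set s : K := -(L₁ + τ * L₂) with hs
  set y' : Fin 3 → Fin 4 → K := Pi.single (0 : Fin 3) (s • t) + Pi.single 1 y₁ + Pi.single 2 (τ • y₂) with hy'
  have hℓ : ℓ y' = 0 := by
    simp only [hy', map_add, Pi.single_smul, map_smul, ht, smul_eq_mul, mul_one]
    show s + L₁ + τ * L₂ = 0
    rw [hs]; ring
  have hXy : X y' = s • A + B + τ • C := by
    simp only [hy', map_add, Pi.single_smul, map_smul, A, B, C]
  have h0 : y' 0 = s • t := by simp [hy']
  have h1 : y' 1 = y₁ := by simp [hy']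
  have h2 : y' 2 = τ • y₂ := by simp [hy']
  have h := hD y' hℓ
  rw [hXy, h0, h1, h2] at h
  simp only [Pi.add_apply, Pi.smul_apply] at h
  rw [firstOrder_row0_expand v t y₁ y₂ A B C L₁ L₂ τ] at h
  linear_combination h

/-- **Row-0 compensation: the off-diagonal blocks into row 0 are `u ⊗ ℓ_b`.**  If `DF_v(y)[X y] = 0` on
`ker ℓ` and `ℓ(e₀ ⊗ t) = 1` (all `v_j ≠ 0`, characteristic `0`), there is ONE vector `u` with
`(X (e₁ ⊗ y₁))₀ = ℓ(e₁ ⊗ y₁) u` and `(X (e₂ ⊗ y₂))₀ = ℓ(e₂ ⊗ y₂) u`. [folklore] -/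
theorem offDiag_row0 [CharZero K] {v : Fin 4 → K} (hv : ∀ j, v j ≠ 0)
    (X : (Fin 3 → Fin 4 → K) →ₗ[K] (Fin 3 → Fin 4 → K)) (ℓ : (Fin 3 → Fin 4 → K) →ₗ[K] K)
    (t : Fin 4 → K) (ht : ℓ (Pi.single 0 t) = 1)
    (hD : ∀ y : Fin 3 → Fin 4 → K, ℓ y = 0 →
      (Matrix.of ![v, X y 0, y 1, y 2]).permanent + (Matrix.of ![v, y 0, X y 1, y 2]).permanent +
        (Matrix.of ![v, y 0, y 1, X y 2]).permanent = 0) :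
    ∃ u : Fin 4 → K, (∀ y₁, X (Pi.single 1 y₁) 0 = ℓ (Pi.single 1 y₁) • u) ∧
      (∀ y₂, X (Pi.single 2 y₂) 0 = ℓ (Pi.single 2 y₂) • u) := by
  classical
  -- row forms and blocks as linear maps
  let ℓ₁ : (Fin 4 → K) →ₗ[K] K := ℓ ∘ₗ LinearMap.single K (fun _ : Fin 3 => Fin 4 → K) 1
  let ℓ₂ : (Fin 4 → K) →ₗ[K] K := ℓ ∘ₗ LinearMap.single K (fun _ : Fin 3 => Fin 4 → K) 2
  let Y₁ : (Fin 4 → K) →ₗ[K] (Fin 4 → K) :=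
    (LinearMap.proj 0) ∘ₗ X ∘ₗ LinearMap.single K (fun _ : Fin 3 => Fin 4 → K) 1
  let Y₂ : (Fin 4 → K) →ₗ[K] (Fin 4 → K) :=
    (LinearMap.proj 0) ∘ₗ X ∘ₗ LinearMap.single K (fun _ : Fin 3 => Fin 4 → K) 2
  have hℓ₁ : ∀ y, ℓ₁ y = ℓ (Pi.single 1 y) := fun _ => rfl
  have hℓ₂ : ∀ y, ℓ₂ y = ℓ (Pi.single 2 y) := fun _ => rfl
  have hY₁ : ∀ y, Y₁ y = X (Pi.single 1 y) 0 := fun _ => rfl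
  have hY₂ : ∀ y, Y₂ y = X (Pi.single 2 y) 0 := fun _ => rfl
  set A := X (Pi.single 0 t) with hA
  -- the common bracket
  let q : (Fin 4 → K) → (Fin 4 → K) → K := fun y₁ y₂ =>
    (Matrix.of ![v, A 0, y₁, y₂]).permanent - ℓ (Pi.single 1 y₁) * (Matrix.of ![v, t, A 1, y₂]).permanent
      + (Matrix.of ![v, t, X (Pi.single 1 y₁) 1, y₂]).permanent
      - ℓ (Pi.single 2 y₂) * (Matrix.of ![v, t, y₁, A 2]).permanent
      + (Matrix.of ![v, t, y₁, X (Pi.single 2 y₂) 2]).permanent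
  -- STEP 1: the block `X₀₁`
  have step1 : (ℓ₁ = 0 → Y₁ = 0) ∧
      (ℓ₁ ≠ 0 → ∀ y₁ y₂, (Matrix.of ![v, Y₁ y₁, y₁, y₂]).permanent = ℓ₁ y₁ * q y₁ y₂) := by
    constructor
    · intro h1
      refine SymPencilPerFourRestrictedQuad.eq_zero_of_perm_quad_mul hv Y₁ ℓ₂
        (fun y₁ => (Matrix.of ![v, t, y₁, X (Pi.single 1 y₁) 2]).permanent) fun y₁ y₂ => ?_
      obtain ⟨-, c1, -, -⟩ := row0_coeffs v X ℓ t ht hD y₁ y₂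
      have h0 : ℓ (Pi.single 1 y₁) = 0 := by rw [← hℓ₁, h1, LinearMap.zero_apply]
      rw [h0] at c1
      rw [hY₁, hℓ₂]
      linear_combination c1
    · intro h1 y₁ y₂
      obtain ⟨y₀, hy₀⟩ : ∃ y₀, ℓ₁ y₀ ≠ 0 := by
        by_contra h0; push Not at h0; exact h1 (LinearMap.ext h0)
      -- quad-kill on the `τ⁰` coefficient
      let Bq : (Fin 4 → K) →ₗ[K] (Fin 4 → K) →ₗ[K] K :=
        LinearMap.mk₂ K (fun y y' => ℓ₁ y * (Matrix.of ![v, t, y', A 2]).permanent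
            - (Matrix.of ![v, t, y, X (Pi.single 1 y') 2]).permanent)
          (fun y y' z => by simp only [map_add, per_add_row₂]; ring)
          (fun c y z => by simp only [map_smul, smul_eq_mul, per_smul_row₂]; ring)
          (fun y z z' => by
            simp only [Pi.single_add, map_add, Pi.add_apply, per_add_row₂, per_add_row₃]; ring)
          (fun c y z => by
            simp only [Pi.single_smul, map_smul, Pi.smul_apply, smul_eq_mul, per_smul_row₂, per_smul_row₃]; ring)
      have hR : ∀ y₁, (Matrix.of ![v, t, y₁, X (Pi.single 1 y₁) 2]).permanent =
          ℓ₁ y₁ * (Matrix.of ![v, t, y₁, A 2]).permanent := by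
        intro y₁
        have hq := quad_eq_zero_of_linear_mul ℓ₁ Bq (fun y => by
          obtain ⟨c0, -, -, -⟩ := row0_coeffs v X ℓ t ht hD y y₀
          simp only [Bq, LinearMap.mk₂_apply, hℓ₁]
          linear_combination c0) hy₀ y₁
        simp only [Bq, LinearMap.mk₂_apply] at hq
        linear_combination -hq
      obtain ⟨-, c1, -, -⟩ := row0_coeffs v X ℓ t ht hD y₁ y₂
      rw [hY₁, hℓ₁]
      simp only [q]
      have hR1 := hR y₁
      rw [hℓ₁] at hR1
      linear_combination c1 + ℓ (Pi.single 2 y₂) * hR1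
  -- STEP 2: the block `X₀₂` (roles of the rows `1, 2` exchanged)
  have step2 : (ℓ₂ = 0 → Y₂ = 0) ∧
      (ℓ₂ ≠ 0 → ∀ y₁ y₂, (Matrix.of ![v, Y₂ y₂, y₂, y₁]).permanent = ℓ₂ y₂ * q y₁ y₂) := by
    constructor
    · intro h2
      refine SymPencilPerFourRestrictedQuad.eq_zero_of_perm_quad_mul hv Y₂ ℓ₁
        (fun y₂ => (Matrix.of ![v, t, X (Pi.single 2 y₂) 1, y₂]).permanent) fun y₂ y₁ => ?_
      obtain ⟨-, -, c2, -⟩ := row0_coeffs v X ℓ t ht hD y₁ y₂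
      have h0 : ℓ (Pi.single 2 y₂) = 0 := by rw [← hℓ₂, h2, LinearMap.zero_apply]
      rw [h0] at c2
      rw [hY₂, hℓ₁, per_swap_row₂₃]
      linear_combination c2
    · intro h2 y₁ y₂
      obtain ⟨y₀, hy₀⟩ : ∃ y₀, ℓ₂ y₀ ≠ 0 := by
        by_contra h0; push Not at h0; exact h2 (LinearMap.ext h0)
      let Bq : (Fin 4 → K) →ₗ[K] (Fin 4 → K) →ₗ[K] K :=
        LinearMap.mk₂ K (fun y y' => ℓ₂ y * (Matrix.of ![v, t, A 1, y']).permanent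
            - (Matrix.of ![v, t, X (Pi.single 2 y') 1, y]).permanent)
          (fun y y' z => by simp only [map_add, per_add_row₃]; ring)
          (fun c y z => by simp only [map_smul, smul_eq_mul, per_smul_row₃]; ring)
          (fun y z z' => by
            simp only [Pi.single_add, map_add, Pi.add_apply, per_add_row₂, per_add_row₃]; ring)
          (fun c y z => by
            simp only [Pi.single_smul, map_smul, Pi.smul_apply, smul_eq_mul, per_smul_row₂, per_smul_row₃]; ring)
      have hR : ∀ y₂, (Matrix.of ![v, t, X (Pi.single 2 y₂) 1, y₂]).permanent =
          ℓ₂ y₂ * (Matrix.of ![v, t, A 1, y₂]).permanent := by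
        intro y₂
        have hq := quad_eq_zero_of_linear_mul ℓ₂ Bq (fun y => by
          obtain ⟨-, -, -, c3⟩ := row0_coeffs v X ℓ t ht hD y₀ y
          simp only [Bq, LinearMap.mk₂_apply, hℓ₂]
          linear_combination c3) hy₀ y₂
        simp only [Bq, LinearMap.mk₂_apply] at hq
        linear_combination -hq
      obtain ⟨-, -, c2, -⟩ := row0_coeffs v X ℓ t ht hD y₁ y₂
      rw [hY₂, hℓ₂, per_swap_row₂₃]
      simp only [q]
      have hR2 := hR y₂
      rw [hℓ₂] at hR2
      linear_combination c2 + ℓ (Pi.single 1 y₁) * hR2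
  -- STEP 3: rank-one blocks and the common vector
  have hu₁ : ∃ u₁ : Fin 4 → K, ∀ y, Y₁ y = ℓ₁ y • u₁ := by
    by_cases h1 : ℓ₁ = 0
    · exact ⟨0, fun y => by rw [step1.1 h1, h1, LinearMap.zero_apply, LinearMap.zero_apply, zero_smul]⟩
    · exact SymPencilPerFourHyperplaneQuad.exists_eq_smul_of_perm_quad_hyperplane hv Y₁ ℓ₁ q (step1.2 h1)
  have hu₂ : ∃ u₂ : Fin 4 → K, ∀ y, Y₂ y = ℓ₂ y • u₂ := by
    by_cases h2 : ℓ₂ = 0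
    · exact ⟨0, fun y => by rw [step2.1 h2, h2, LinearMap.zero_apply, LinearMap.zero_apply, zero_smul]⟩
    · exact SymPencilPerFourHyperplaneQuad.exists_eq_smul_of_perm_quad_hyperplane hv Y₂ ℓ₂ (fun y₂ y₁ => q y₁ y₂)
        fun y₂ y₁ => step2.2 h2 y₁ y₂
  obtain ⟨u₁, hu₁⟩ := hu₁
  obtain ⟨u₂, hu₂⟩ := hu₂
  by_cases h1 : ℓ₁ = 0
  · refine ⟨u₂, fun y₁ => ?_, fun y₂ => ?_⟩
    · rw [← hY₁, hu₁, ← hℓ₁, h1, LinearMap.zero_apply, zero_smul, zero_smul]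
    · rw [← hY₂, hu₂, hℓ₂]
  by_cases h2 : ℓ₂ = 0
  · refine ⟨u₁, fun y₁ => ?_, fun y₂ => ?_⟩
    · rw [← hY₁, hu₁, hℓ₁]
    · rw [← hY₂, hu₂, ← hℓ₂, h2, LinearMap.zero_apply, zero_smul, zero_smul]
  -- both row forms non-zero: `u₁ = u₂` from the shared bracket
  obtain ⟨z₁, hz₁⟩ : ∃ z, ℓ₁ z ≠ 0 := by by_contra h0; push Not at h0; exact h1 (LinearMap.ext h0)
  obtain ⟨z₂, hz₂⟩ : ∃ z, ℓ₂ z ≠ 0 := by by_contra h0; push Not at h0; exact h2 (LinearMap.ext h0)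
  have h12 : ∀ y₁ y₂, ℓ₁ y₁ * (ℓ₂ y₂ * (Matrix.of ![v, u₁ - u₂, y₁, y₂]).permanent) = 0 := by
    intro y₁ y₂
    have e1 := step1.2 h1 y₁ y₂
    have e2 := step2.2 h2 y₁ y₂
    rw [hu₁, permanent_rows_smul₁] at e1
    rw [hu₂, permanent_rows_smul₁, per_swap_row₂₃] at e2
    rw [show u₁ - u₂ = u₁ + (-1 : K) • u₂ by rw [neg_one_smul, sub_eq_add_neg], per_add_row₁, permanent_rows_smul₁]
    linear_combination ℓ₂ y₂ * e1 - ℓ₁ y₁ * e2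
  -- density in `y₁`, then in `y₂`
  have h2' : ∀ y₁ y₂, ℓ₂ y₂ * (Matrix.of ![v, u₁ - u₂, y₁, y₂]).permanent = 0 := by
    intro y₁ y₂
    let f : (Fin 4 → K) →ₗ[K] K := LinearMap.mk₂ K (fun a b : Fin 4 → K => (Matrix.of ![v, u₁ - u₂, a, b]).permanent)
        (fun a a' b => per_add_row₂ _ _ _ _ _) (fun c a b => per_smul_row₂ _ _ _ _ _)
        (fun a b b' => per_add_row₃ _ _ _ _ _) (fun c a b => per_smul_row₃ _ _ _ _ _) |>.flip y₂
    have hf : ∀ a, f a = (Matrix.of ![v, u₁ - u₂, a, y₂]).permanent := fun a => rfl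
    have key := linear_eq_zero_of_forall_mul ℓ₁ ((ℓ₂ y₂) • f) hz₁ fun y => by
      rw [LinearMap.smul_apply, hf, smul_eq_mul, smul_eq_mul]; exact h12 y y₂
    have := LinearMap.congr_fun key y₁
    rw [LinearMap.smul_apply, hf, LinearMap.zero_apply, smul_eq_mul] at this
    exact this
  have h3 : ∀ y₁ y₂, (Matrix.of ![v, u₁ - u₂, y₁, y₂]).permanent = 0 := by
    intro y₁ y₂
    let g : (Fin 4 → K) →ₗ[K] K := LinearMap.mk₂ K (fun a b : Fin 4 → K => (Matrix.of ![v, u₁ - u₂, a, b]).permanent)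
        (fun a a' b => per_add_row₂ _ _ _ _ _) (fun c a b => per_smul_row₂ _ _ _ _ _)
        (fun a b b' => per_add_row₃ _ _ _ _ _) (fun c a b => per_smul_row₃ _ _ _ _ _) y₁
    have hg : ∀ b, g b = (Matrix.of ![v, u₁ - u₂, y₁, b]).permanent := fun b => rfl
    have key := linear_eq_zero_of_forall_mul ℓ₂ g hz₂ fun y => by rw [hg, smul_eq_mul]; exact h2' y₁ y
    have := LinearMap.congr_fun key y₂
    rwa [hg, LinearMap.zero_apply] at this
  have hu : u₁ = u₂ := by
    have := eq_zero_of_perm_lin hv (u₁ - u₂) h3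
    rwa [sub_eq_zero] at this
  refine ⟨u₁, fun y₁ => ?_, fun y₂ => ?_⟩
  · rw [← hY₁, hu₁, hℓ₁]
  · rw [← hY₂, hu₂, hℓ₂, hu]

end Summit.ValiantsHypothesis.ValiantsHypothesis.Theorems.SymPencilPerFourHyperplaneFlowBlocks

end
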